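import Summits.QuantumFields.BalabanUV.Beta.D1BFx.DshWordFaceMass
import Summits.QuantumFields.BalabanUV.Beta.BorderedHessianSymmetry

/-!
# `BalabanUV.Beta.D1BFx.DshWordSplitTadpole` — road «BF-x», binder row D1, PART 24-hyb HEAD: **THE `Dsh`-WORD TADPOLE AGAINST A SIGN-SYMMETRIC LEG WITH INTERIOR ∕ FACE
# COLUMN LETTERS IS A (5.10)-KERNEL — `Decay510 (z ↦ ½·tadpole G ([diagK (h z),[diagK g, Dsh n]])) (½·2·(Ch·Cg·(e^{8nδ}+1)²·(4·(2·(Si·T₀ + Sf·F₀)))·Zl 4 (δ∕2·n))) (δ∕2·n)`: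
# NET `Si·n⁵ + Sf·n⁴`** (FILE 5; FILE 4 `DshWordFaceMass` = the weighted masses, FILE 6 `ChartDefectRowDdUniform` = the record at the HEAD's own pin)

HONEST DEPENDENCY (cell records, verbatim): «continuum YM on T⁴ ⇐ BetaPertH ∧ nine spine estimates (0/9 proved); BetaPertH ⇐ (D1) ∧ (D4) ∧
CAP+tail; G-an2-4 gates asym, D1 and NE2/3/4.»  HONEST FRAMING (cell contract, verbatim): «discharging `BetaPertH` makes Bałaban's UV stability
UNCONDITIONAL — a real constructive-QFT result; it is NOT the continuum limit and NOT the Clay problem.»  THIS MODULE is [folklore] `ℓ¹` bookkeeping BY NAME over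
FILES 1∕4 and d1-leaf-04's `GhostWordEnvelope` plumbing (its `abs_tadpole_le_of_bdd_mass` GENERALISED to an entrywise MAJORANT `ω y x f a` of the leg on the table's support —
`abs_tadpole_le_of_weightOn_mass`); the sign symmetry `trK G = sgnK G` (an2's `BorderedHessianSymmetry`; in the tree for both pins: `BubbleParity.trK_KInvStep ∕
trK_coDressKBmAt_KInvStep`) turns the multiplier–field rows into the field–multiplier columns.  The LEG letters `|colH G n μ Y κ u| ≤ Si` (bond inside a block) ∕ `≤ Sf` (all bonds)
are DISPLAYED hypotheses on an ARBITRARY packed kernel.  No `def`, no `def … : Prop`, nothing cited, 0 sorry.  0∕4 row-D1 binders; (K) NOT closed; (J1) ONE OPEN ROW; NOT D1,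
NEVER «G-an2-4 closed», NOT `BetaPertH`, NOT continuum, NOT Clay.

ABSOLUTE RULE (cell charter, verbatim): «No internally-minted statement may enter as a cited fact. Every hypothesis is either kernel-proved in
this package or a verbatim quotation of a PUBLISHED theorem with page reference. The manuscript(s) under audit are NOT citable for their own
disputed steps — they are the thing under adjudication; programme-internal (2001/route/tribunal) claims are never citable.»

CONTENT ([folklore]).  §9 **`abs_tadpole_le_of_weightOn_mass`** (generic `D`, `F`); `word_col_wsummable`, `fibreWMass_word_eq`, `word_inl_inr_prod_wmass_le`, **`word_wmass_le`**
(the weighted full mass on `ℤ⁴ × ℤ⁴`, mirror block by `abs_word_inr_inl`); `splitWeight_nonneg`, **`abs_leg_le_splitWeight`** (the leg letter on the word's support, face-split);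
**`decay510_half_tadpole_word_split`**.  Unit `b2b-balaban-beta-d1-formalise-leaf-01` (gen 33), road «BF-x»; OFFER O-10 part 2.  Not in print; our bookkeeping.  No existing file touched.
-/

noncomputable section

namespace Summit.QuantumFields.BalabanUV.Beta.D1BFx.DshWordSplitTadpole

open Finset
open scoped BigOperators
open Literature.MathematicalPhysics.QuantumFieldTheory
open Literature.MathematicalPhysics.QuantumFieldTheory.LatticeForm (quo)
open Literature.MathematicalPhysics.QuantumFieldTheory.Balaban1983to89
open Literature.MathematicalPhysics.QuantumFieldTheory.Balaban1983to89.Beta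
open B12Sec2to5 (l1 l1_nonneg Decay510)
open ExpKernelCalculus (MKer Zl comp tr tadpole)
open OneStepResolventKernel (Fib eq_zsmul_quo_of_proj)
open OneStepKernelFamily (colH)
open AffineAveraging (Site unitVec)
open AveragingContours (blk)
open Summit.QuantumFields.BalabanUV.Beta.BorderedHessian (diagK sgnK sgnK_apply sgnF_inl sgnF_inr)
open Summit.QuantumFields.BalabanUV.Beta.TameKernelCalculus (trK trK_apply)
open Summit.QuantumFields.BalabanUV.Beta.DshAn1 (Dsh)
open Summit.QuantumFields.BalabanUV.Beta.D1BFx.GhostWordEnvelope (summable_section_snd summable_tsum_snd tsum_tsum_snd_eq)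
open Summit.QuantumFields.BalabanUV.Beta.D1BFx.DshWordMass
open Summit.QuantumFields.BalabanUV.Beta.D1BFx.DshWordFaceMass

/-! ## §9 The weighted tadpole and the weighted full mass: interior ∕ face column letters -/

section WeightedTool

variable {D : ℕ} {F : Type*} [Fintype F]

/-- [folklore] **THE TADPOLE WORD AGAINST A LEG MAJORISED ENTRYWISE ON THE TABLE's SUPPORT** (the weighted twin of FILE 1 §0 `abs_tadpole_le_of_bddOn_mass`): a weight
`ω y x f a ≥ 0` with `|L x y a f| ≤ ω y x f a` wherever `W y x f a ≠ 0`, and `Σ'_{(y,x)} Σ_{f a} ω·|W|` absolutely convergent, give `|tadpole L W| ≤ Σ'_{(y,x)} Σ_{f a} ω y x f a·|W y x f a|`. -/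
theorem abs_tadpole_le_of_weightOn_mass {L W : MKer D F} {ω : Site D → Site D → F → F → ℝ} (hω : ∀ y x f a, 0 ≤ ω y x f a)
    (hL : ∀ x y a f, W y x f a ≠ 0 → |L x y a f| ≤ ω y x f a)
    (hW : Summable fun p : Site D × Site D => ∑ f, ∑ a, ω p.1 p.2 f a * |W p.1 p.2 f a|) :
    |tadpole L W| ≤ ∑' p : Site D × Site D, ∑ f, ∑ a, ω p.1 p.2 f a * |W p.1 p.2 f a| := by
  have hsec : ∀ x, Summable fun y : Site D => ∑ f, ∑ a, ω y x f a * |W y x f a| := fun x =>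
    summable_section_snd (Φ := fun y x => ∑ f, ∑ a, ω y x f a * |W y x f a|) hW x
  have hseca : ∀ x a, Summable fun y : Site D => ∑ f, ω y x f a * |W y x f a| := fun x a =>
    Summable.of_nonneg_of_le (fun y => Finset.sum_nonneg fun f _ => mul_nonneg (hω y x f a) (abs_nonneg _))
      (fun y => Finset.sum_le_sum fun f _ =>
        Finset.single_le_sum (f := fun a' => ω y x f a' * |W y x f a'|) (fun a' _ => mul_nonneg (hω y x f a') (abs_nonneg _)) (Finset.mem_univ a))
      (hsec x)
  have hcol : Summable fun x : Site D => ∑' y : Site D, ∑ f, ∑ a, ω y x f a * |W y x f a| :=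
    summable_tsum_snd (Φ := fun y x => ∑ f, ∑ a, ω y x f a * |W y x f a|) hW
  have hterm : ∀ x y a f, |L x y a f * W y x f a| ≤ ω y x f a * |W y x f a| := by
    intro x y a f
    by_cases h0 : W y x f a = 0
    · rw [h0, mul_zero, abs_zero, mul_zero]
    · rw [abs_mul]; exact mul_le_mul_of_nonneg_right (hL x y a f h0) (abs_nonneg _)
  have hinner : ∀ x a, |comp L W x x a a| ≤ ∑' y : Site D, ∑ f, ω y x f a * |W y x f a| := by
    intro x a
    unfold ExpKernelCalculus.comp
    have hb := tsum_of_norm_bounded (f := fun y => ∑ f, L x y a f * W y x f a) (hseca x a).hasSum (fun y => by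
      rw [Real.norm_eq_abs]
      exact (Finset.abs_sum_le_sum_abs _ _).trans (Finset.sum_le_sum fun f _ => hterm x y a f))
    rw [Real.norm_eq_abs] at hb
    exact hb
  have hfib : ∀ x, ∑ a, ∑' y : Site D, ∑ f, ω y x f a * |W y x f a| = ∑' y : Site D, ∑ f, ∑ a, ω y x f a * |W y x f a| := by
    intro x
    rw [← Summable.tsum_finsetSum (fun a _ => hseca x a)]
    exact tsum_congr fun y => Finset.sum_comm
  unfold ExpKernelCalculus.tadpole ExpKernelCalculus.tr
  have hb := tsum_of_norm_bounded (f := fun x => ∑ a, comp L W x x a a) hcol.hasSum (fun x => by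
    rw [Real.norm_eq_abs]
    calc |∑ a, comp L W x x a a| ≤ ∑ a, |comp L W x x a a| := Finset.abs_sum_le_sum_abs _ _
      _ ≤ ∑ a, ∑' y : Site D, ∑ f, ω y x f a * |W y x f a| := Finset.sum_le_sum fun a _ => hinner x a
      _ = ∑' y : Site D, ∑ f, ∑ a, ω y x f a * |W y x f a| := hfib x)
  rw [Real.norm_eq_abs, tsum_tsum_snd_eq (Φ := fun y x => ∑ f, ∑ a, ω y x f a * |W y x f a|) hW] at hb
  exact hb

end WeightedTool

section WeightedMass

variable {n : ℕ} [NeZero n]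
variable (g h : Site (3 + 1) → Fib 3 → ℝ) {Cg Ch δ : ℝ} {yb yz : Site (3 + 1)}

/-- [folklore] Every weighted column of the word's field–multiplier block is summable (coarse columns: `word_col_wmass_le`; the others vanish). -/
theorem word_col_wsummable (hCg : 0 ≤ Cg) (hCh : 0 ≤ Ch) (hδ : 0 ≤ δ) {Si Sf : ℝ} (hSi : 0 ≤ Si) (hSf : 0 ≤ Sf)
    (hg : ∀ x a, |g x a| ≤ Cg * Real.exp (-δ * l1 (x - (n : ℤ) • yb))) (hh : ∀ x a, |h x a| ≤ Ch * Real.exp (-δ * l1 (x - (n : ℤ) • yz)))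
    (x : Site (3 + 1)) :
    Summable fun y : Site (3 + 1) => ∑ α : Fin (3 + 1), ∑ m : Fin (3 + 1), (if blk n (y + unitVec α) = blk n y then Si else Sf) * |(comp (diagK h) (comp (diagK g) (Dsh (d := 3) n) - comp (Dsh (d := 3) n) (diagK g))
            - comp (comp (diagK g) (Dsh (d := 3) n) - comp (Dsh (d := 3) n) (diagK g)) (diagK h)) y x (Sum.inl α) (Sum.inr m)| := by
  by_cases hx : Literature.Probability.LatticeModels.Torus.proj n x = 0
  · have ex : x = (n : ℤ) • quo n x := eq_zsmul_quo_of_proj (N := n) hx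
    rw [ex]
    exact (word_col_wmass_le g h hCg hCh hδ hSi hSf hg hh (quo n x)).1
  · have h0 : (fun y : Site (3 + 1) => ∑ α : Fin (3 + 1), ∑ m : Fin (3 + 1), (if blk n (y + unitVec α) = blk n y then Si else Sf) * |(comp (diagK h) (comp (diagK g) (Dsh (d := 3) n) - comp (Dsh (d := 3) n) (diagK g))
            - comp (comp (diagK g) (Dsh (d := 3) n) - comp (Dsh (d := 3) n) (diagK g)) (diagK h)) y x (Sum.inl α) (Sum.inr m)|) = fun _ => 0 := by
      funext y
      simp only [word_inl_inr_eq_zero_of_proj_ne g h hx, abs_zero, mul_zero, Finset.sum_const_zero]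
    rw [h0]
    exact summable_zero

omit [NeZero n] in
/-- [folklore] The weighted fibre mass of the word at a pair of sites (weights `Ω`: the bond weight `w(α, ·)` read at the FIELD index of each off-diagonal entry, `0` on the
diagonal blocks) splits into the two off-diagonal blocks, the second mirrored. -/
theorem fibreWMass_word_eq (Si Sf : ℝ) (p : Site (3 + 1) × Site (3 + 1)) :
    ∑ f : Fib 3, ∑ a : Fib 3, (match f, a with
        | Sum.inl α, Sum.inr _ => (if blk n (p.1 + unitVec α) = blk n p.1 then Si else Sf)
        | Sum.inr _, Sum.inl α => (if blk n (p.2 + unitVec α) = blk n p.2 then Si else Sf)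
        | _, _ => (0 : ℝ)) * |(comp (diagK h) (comp (diagK g) (Dsh (d := 3) n) - comp (Dsh (d := 3) n) (diagK g))
            - comp (comp (diagK g) (Dsh (d := 3) n) - comp (Dsh (d := 3) n) (diagK g)) (diagK h)) p.1 p.2 f a|
      = (∑ α : Fin (3 + 1), ∑ m : Fin (3 + 1), (if blk n (p.1 + unitVec α) = blk n p.1 then Si else Sf) * |(comp (diagK h) (comp (diagK g) (Dsh (d := 3) n) - comp (Dsh (d := 3) n) (diagK g))
            - comp (comp (diagK g) (Dsh (d := 3) n) - comp (Dsh (d := 3) n) (diagK g)) (diagK h)) p.1 p.2 (Sum.inl α) (Sum.inr m)|)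
        + ∑ α : Fin (3 + 1), ∑ m : Fin (3 + 1), (if blk n (p.2 + unitVec α) = blk n p.2 then Si else Sf) * |(comp (diagK h) (comp (diagK g) (Dsh (d := 3) n) - comp (Dsh (d := 3) n) (diagK g))
            - comp (comp (diagK g) (Dsh (d := 3) n) - comp (Dsh (d := 3) n) (diagK g)) (diagK h)) p.2 p.1 (Sum.inl α) (Sum.inr m)| := by
  rw [Fintype.sum_sum_type]
  congr 1
  · refine Finset.sum_congr rfl fun α _ => ?_
    rw [Fintype.sum_sum_type]
    simp only [word_inl_inl, abs_zero, mul_zero, Finset.sum_const_zero, zero_add]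
  · simp only [Fintype.sum_sum_type, word_inr_inr, abs_zero, mul_zero, Finset.sum_const_zero, add_zero, abs_word_inr_inl]
    exact Finset.sum_comm

/-- [folklore] The word's weighted field–multiplier block as a function on `ℤ⁴ × ℤ⁴`: summable with the bound of `word_inl_inr_wmass_le`. -/
theorem word_inl_inr_prod_wmass_le (hCg : 0 ≤ Cg) (hCh : 0 ≤ Ch) (hδ : 0 < δ) {Si Sf : ℝ} (hSi : 0 ≤ Si) (hSf : 0 ≤ Sf)
    (hg : ∀ x a, |g x a| ≤ Cg * Real.exp (-δ * l1 (x - (n : ℤ) • yb))) (hh : ∀ x a, |h x a| ≤ Ch * Real.exp (-δ * l1 (x - (n : ℤ) • yz))) :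
    (Summable fun p : Site (3 + 1) × Site (3 + 1) => ∑ α : Fin (3 + 1), ∑ m : Fin (3 + 1),
        (if blk n (p.1 + unitVec α) = blk n p.1 then Si else Sf) * |(comp (diagK h) (comp (diagK g) (Dsh (d := 3) n) - comp (Dsh (d := 3) n) (diagK g))
            - comp (comp (diagK g) (Dsh (d := 3) n) - comp (Dsh (d := 3) n) (diagK g)) (diagK h)) p.1 p.2 (Sum.inl α) (Sum.inr m)|) ∧
      ∑' p : Site (3 + 1) × Site (3 + 1), ∑ α : Fin (3 + 1), ∑ m : Fin (3 + 1),
          (if blk n (p.1 + unitVec α) = blk n p.1 then Si else Sf) * |(comp (diagK h) (comp (diagK g) (Dsh (d := 3) n) - comp (Dsh (d := 3) n) (diagK g))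
            - comp (comp (diagK g) (Dsh (d := 3) n) - comp (Dsh (d := 3) n) (diagK g)) (diagK h)) p.1 p.2 (Sum.inl α) (Sum.inr m)|
        ≤ (Ch * Cg * (Real.exp (δ * (((3 : ℝ) + 1) * (2 * n))) + 1) ^ 2 * (4 * (2 * (Si * ((n : ℝ) ^ (3 + 1) * (((3 : ℝ) + 1) * n)) + Sf * (((3 : ℝ) + 1) * ((((3 : ℕ) : ℝ) + 1) * (n : ℝ) ^ (3 + 1))))))
            * Zl 4 (δ / 2 * n)) * Real.exp (-(δ / 2 * n) * l1 (yz - yb)) := by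
  have hw0 : ∀ (y : Site (3 + 1)) (α : Fin (3 + 1)), 0 ≤ (if blk n (y + unitVec α) = blk n y then Si else Sf) := fun y α => by split_ifs <;> assumption
  have hG : Summable fun q : Site (3 + 1) × Site (3 + 1) => ∑ α : Fin (3 + 1), ∑ m : Fin (3 + 1),
      (if blk n (q.2 + unitVec α) = blk n q.2 then Si else Sf) * |(comp (diagK h) (comp (diagK g) (Dsh (d := 3) n) - comp (Dsh (d := 3) n) (diagK g))
            - comp (comp (diagK g) (Dsh (d := 3) n) - comp (Dsh (d := 3) n) (diagK g)) (diagK h)) q.2 q.1 (Sum.inl α) (Sum.inr m)| := by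
    refine (summable_prod_of_nonneg fun q => Finset.sum_nonneg fun α _ => Finset.sum_nonneg fun m _ => mul_nonneg (hw0 _ α) (abs_nonneg _)).2 ⟨fun x => ?_, ?_⟩
    · exact word_col_wsummable g h hCg hCh hδ.le hSi hSf hg hh x
    · exact (word_inl_inr_wmass_le g h hCg hCh hδ hSi hSf hg hh).1
  have hGs := ((Equiv.prodComm (Site (3 + 1)) (Site (3 + 1))).summable_iff
    (f := fun p : Site (3 + 1) × Site (3 + 1) => ∑ α : Fin (3 + 1), ∑ m : Fin (3 + 1), (if blk n (p.1 + unitVec α) = blk n p.1 then Si else Sf) * |(comp (diagK h) (comp (diagK g) (Dsh (d := 3) n) - comp (Dsh (d := 3) n) (diagK g))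
            - comp (comp (diagK g) (Dsh (d := 3) n) - comp (Dsh (d := 3) n) (diagK g)) (diagK h)) p.1 p.2 (Sum.inl α) (Sum.inr m)|)).1 hG
  refine ⟨hGs, ?_⟩
  rw [← (Equiv.prodComm (Site (3 + 1)) (Site (3 + 1))).tsum_eq
    (fun p : Site (3 + 1) × Site (3 + 1) => ∑ α : Fin (3 + 1), ∑ m : Fin (3 + 1), (if blk n (p.1 + unitVec α) = blk n p.1 then Si else Sf) * |(comp (diagK h) (comp (diagK g) (Dsh (d := 3) n) - comp (Dsh (d := 3) n) (diagK g))
            - comp (comp (diagK g) (Dsh (d := 3) n) - comp (Dsh (d := 3) n) (diagK g)) (diagK h)) p.1 p.2 (Sum.inl α) (Sum.inr m)|)]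
  show ∑' q : Site (3 + 1) × Site (3 + 1), ∑ α : Fin (3 + 1), ∑ m : Fin (3 + 1), (if blk n (q.2 + unitVec α) = blk n q.2 then Si else Sf) * |(comp (diagK h) (comp (diagK g) (Dsh (d := 3) n) - comp (Dsh (d := 3) n) (diagK g))
            - comp (comp (diagK g) (Dsh (d := 3) n) - comp (Dsh (d := 3) n) (diagK g)) (diagK h)) q.2 q.1 (Sum.inl α) (Sum.inr m)| ≤ _
  rw [hG.tsum_prod' (fun x => word_col_wsummable g h hCg hCh hδ.le hSi hSf hg hh x)]
  exact (word_inl_inr_wmass_le g h hCg hCh hδ hSi hSf hg hh).2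

/-- [folklore] **THE WEIGHTED FULL `ℓ¹` MASS OF THE `Dsh`-WORD** (interior bonds `Si`, face-crossing bonds `Sf`): summable on `ℤ⁴ × ℤ⁴`, and
`Σ'_{(y,x)} Σ_{f a} Ω·|W y x f a| ≤ 2·(Ch·Cg·(E+1)²·(4·(2·(Si·T₀ + Sf·F₀)))·Zl 4 (δ∕2·n))·e^{−(δ∕2·n)|yz − yb|₁}` with `T₀ = n^{3+1}·((3+1)·n)` (O-6) and
`F₀ = (3+1)·((3+1)·n^{3+1})` (O-6′) — ONE POWER of `n` apart. -/
theorem word_wmass_le (hCg : 0 ≤ Cg) (hCh : 0 ≤ Ch) (hδ : 0 < δ) {Si Sf : ℝ} (hSi : 0 ≤ Si) (hSf : 0 ≤ Sf)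
    (hg : ∀ x a, |g x a| ≤ Cg * Real.exp (-δ * l1 (x - (n : ℤ) • yb))) (hh : ∀ x a, |h x a| ≤ Ch * Real.exp (-δ * l1 (x - (n : ℤ) • yz))) :
    (Summable fun p : Site (3 + 1) × Site (3 + 1) => ∑ f : Fib 3, ∑ a : Fib 3, (match f, a with
        | Sum.inl α, Sum.inr _ => (if blk n (p.1 + unitVec α) = blk n p.1 then Si else Sf)
        | Sum.inr _, Sum.inl α => (if blk n (p.2 + unitVec α) = blk n p.2 then Si else Sf)
        | _, _ => (0 : ℝ)) * |(comp (diagK h) (comp (diagK g) (Dsh (d := 3) n) - comp (Dsh (d := 3) n) (diagK g))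
            - comp (comp (diagK g) (Dsh (d := 3) n) - comp (Dsh (d := 3) n) (diagK g)) (diagK h)) p.1 p.2 f a|) ∧
      ∑' p : Site (3 + 1) × Site (3 + 1), ∑ f : Fib 3, ∑ a : Fib 3, (match f, a with
        | Sum.inl α, Sum.inr _ => (if blk n (p.1 + unitVec α) = blk n p.1 then Si else Sf)
        | Sum.inr _, Sum.inl α => (if blk n (p.2 + unitVec α) = blk n p.2 then Si else Sf)
        | _, _ => (0 : ℝ)) * |(comp (diagK h) (comp (diagK g) (Dsh (d := 3) n) - comp (Dsh (d := 3) n) (diagK g))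
            - comp (comp (diagK g) (Dsh (d := 3) n) - comp (Dsh (d := 3) n) (diagK g)) (diagK h)) p.1 p.2 f a|
        ≤ 2 * (Ch * Cg * (Real.exp (δ * (((3 : ℝ) + 1) * (2 * n))) + 1) ^ 2 * (4 * (2 * (Si * ((n : ℝ) ^ (3 + 1) * (((3 : ℝ) + 1) * n)) + Sf * (((3 : ℝ) + 1) * ((((3 : ℕ) : ℝ) + 1) * (n : ℝ) ^ (3 + 1))))))
            * Zl 4 (δ / 2 * n)) * Real.exp (-(δ / 2 * n) * l1 (yz - yb)) := by
  obtain ⟨h1s, h1v⟩ := word_inl_inr_prod_wmass_le g h (yb := yb) (yz := yz) hCg hCh hδ hSi hSf hg hh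
  have h2s := (Equiv.prodComm (Site (3 + 1)) (Site (3 + 1))).summable_iff.2 h1s
  have h2v : ∑' p : Site (3 + 1) × Site (3 + 1), ((fun p : Site (3 + 1) × Site (3 + 1) => ∑ α : Fin (3 + 1), ∑ m : Fin (3 + 1), (if blk n (p.1 + unitVec α) = blk n p.1 then Si else Sf) * |(comp (diagK h) (comp (diagK g) (Dsh (d := 3) n) - comp (Dsh (d := 3) n) (diagK g))
            - comp (comp (diagK g) (Dsh (d := 3) n) - comp (Dsh (d := 3) n) (diagK g)) (diagK h)) p.1 p.2 (Sum.inl α) (Sum.inr m)|) ∘ ⇑(Equiv.prodComm (Site (3 + 1)) (Site (3 + 1)))) p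
      = ∑' p : Site (3 + 1) × Site (3 + 1), (fun p : Site (3 + 1) × Site (3 + 1) => ∑ α : Fin (3 + 1), ∑ m : Fin (3 + 1), (if blk n (p.1 + unitVec α) = blk n p.1 then Si else Sf) * |(comp (diagK h) (comp (diagK g) (Dsh (d := 3) n) - comp (Dsh (d := 3) n) (diagK g))
            - comp (comp (diagK g) (Dsh (d := 3) n) - comp (Dsh (d := 3) n) (diagK g)) (diagK h)) p.1 p.2 (Sum.inl α) (Sum.inr m)|) p :=
    (Equiv.prodComm (Site (3 + 1)) (Site (3 + 1))).tsum_eq (fun p : Site (3 + 1) × Site (3 + 1) => ∑ α : Fin (3 + 1), ∑ m : Fin (3 + 1), (if blk n (p.1 + unitVec α) = blk n p.1 then Si else Sf) * |(comp (diagK h) (comp (diagK g) (Dsh (d := 3) n) - comp (Dsh (d := 3) n) (diagK g))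
            - comp (comp (diagK g) (Dsh (d := 3) n) - comp (Dsh (d := 3) n) (diagK g)) (diagK h)) p.1 p.2 (Sum.inl α) (Sum.inr m)|)
  have hpt : ∀ p : Site (3 + 1) × Site (3 + 1), (∑ f : Fib 3, ∑ a : Fib 3, (match f, a with
        | Sum.inl α, Sum.inr _ => (if blk n (p.1 + unitVec α) = blk n p.1 then Si else Sf)
        | Sum.inr _, Sum.inl α => (if blk n (p.2 + unitVec α) = blk n p.2 then Si else Sf)
        | _, _ => (0 : ℝ)) * |(comp (diagK h) (comp (diagK g) (Dsh (d := 3) n) - comp (Dsh (d := 3) n) (diagK g))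
            - comp (comp (diagK g) (Dsh (d := 3) n) - comp (Dsh (d := 3) n) (diagK g)) (diagK h)) p.1 p.2 f a|)
      = (fun p : Site (3 + 1) × Site (3 + 1) => ∑ α : Fin (3 + 1), ∑ m : Fin (3 + 1), (if blk n (p.1 + unitVec α) = blk n p.1 then Si else Sf) * |(comp (diagK h) (comp (diagK g) (Dsh (d := 3) n) - comp (Dsh (d := 3) n) (diagK g))
            - comp (comp (diagK g) (Dsh (d := 3) n) - comp (Dsh (d := 3) n) (diagK g)) (diagK h)) p.1 p.2 (Sum.inl α) (Sum.inr m)|) p + ((fun p : Site (3 + 1) × Site (3 + 1) => ∑ α : Fin (3 + 1), ∑ m : Fin (3 + 1), (if blk n (p.1 + unitVec α) = blk n p.1 then Si else Sf) * |(comp (diagK h) (comp (diagK g) (Dsh (d := 3) n) - comp (Dsh (d := 3) n) (diagK g))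
            - comp (comp (diagK g) (Dsh (d := 3) n) - comp (Dsh (d := 3) n) (diagK g)) (diagK h)) p.1 p.2 (Sum.inl α) (Sum.inr m)|) ∘ ⇑(Equiv.prodComm (Site (3 + 1)) (Site (3 + 1)))) p := by
    intro p
    rw [fibreWMass_word_eq g h Si Sf p]
    rfl
  refine ⟨(h1s.add h2s).congr fun p => (hpt p).symm, ?_⟩
  calc (∑' p : Site (3 + 1) × Site (3 + 1), ∑ f : Fib 3, ∑ a : Fib 3, (match f, a with
        | Sum.inl α, Sum.inr _ => (if blk n (p.1 + unitVec α) = blk n p.1 then Si else Sf)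
        | Sum.inr _, Sum.inl α => (if blk n (p.2 + unitVec α) = blk n p.2 then Si else Sf)
        | _, _ => (0 : ℝ)) * |(comp (diagK h) (comp (diagK g) (Dsh (d := 3) n) - comp (Dsh (d := 3) n) (diagK g))
            - comp (comp (diagK g) (Dsh (d := 3) n) - comp (Dsh (d := 3) n) (diagK g)) (diagK h)) p.1 p.2 f a|)
      = ∑' p : Site (3 + 1) × Site (3 + 1), ((fun p : Site (3 + 1) × Site (3 + 1) => ∑ α : Fin (3 + 1), ∑ m : Fin (3 + 1), (if blk n (p.1 + unitVec α) = blk n p.1 then Si else Sf) * |(comp (diagK h) (comp (diagK g) (Dsh (d := 3) n) - comp (Dsh (d := 3) n) (diagK g))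
            - comp (comp (diagK g) (Dsh (d := 3) n) - comp (Dsh (d := 3) n) (diagK g)) (diagK h)) p.1 p.2 (Sum.inl α) (Sum.inr m)|) p + ((fun p : Site (3 + 1) × Site (3 + 1) => ∑ α : Fin (3 + 1), ∑ m : Fin (3 + 1), (if blk n (p.1 + unitVec α) = blk n p.1 then Si else Sf) * |(comp (diagK h) (comp (diagK g) (Dsh (d := 3) n) - comp (Dsh (d := 3) n) (diagK g))
            - comp (comp (diagK g) (Dsh (d := 3) n) - comp (Dsh (d := 3) n) (diagK g)) (diagK h)) p.1 p.2 (Sum.inl α) (Sum.inr m)|) ∘ ⇑(Equiv.prodComm (Site (3 + 1)) (Site (3 + 1)))) p) := tsum_congr hpt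
    _ = (∑' p : Site (3 + 1) × Site (3 + 1), (fun p : Site (3 + 1) × Site (3 + 1) => ∑ α : Fin (3 + 1), ∑ m : Fin (3 + 1), (if blk n (p.1 + unitVec α) = blk n p.1 then Si else Sf) * |(comp (diagK h) (comp (diagK g) (Dsh (d := 3) n) - comp (Dsh (d := 3) n) (diagK g))
            - comp (comp (diagK g) (Dsh (d := 3) n) - comp (Dsh (d := 3) n) (diagK g)) (diagK h)) p.1 p.2 (Sum.inl α) (Sum.inr m)|) p) + ∑' p : Site (3 + 1) × Site (3 + 1), ((fun p : Site (3 + 1) × Site (3 + 1) => ∑ α : Fin (3 + 1), ∑ m : Fin (3 + 1), (if blk n (p.1 + unitVec α) = blk n p.1 then Si else Sf) * |(comp (diagK h) (comp (diagK g) (Dsh (d := 3) n) - comp (Dsh (d := 3) n) (diagK g))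
            - comp (comp (diagK g) (Dsh (d := 3) n) - comp (Dsh (d := 3) n) (diagK g)) (diagK h)) p.1 p.2 (Sum.inl α) (Sum.inr m)|) ∘ ⇑(Equiv.prodComm (Site (3 + 1)) (Site (3 + 1)))) p := h1s.tsum_add h2s
    _ ≤ _ := by rw [h2v]; linarith

omit [NeZero n] in
/-- [folklore] The face-split weight is nonnegative (`0 ≤ Si, Sf`). -/
theorem splitWeight_nonneg {Si Sf : ℝ} (hSi : 0 ≤ Si) (hSf : 0 ≤ Sf) (y x : Site (3 + 1)) (f a : Fib 3) :
    0 ≤ (match f, a with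
        | Sum.inl α, Sum.inr _ => (if blk n (y + unitVec α) = blk n y then Si else Sf)
        | Sum.inr _, Sum.inl α => (if blk n (x + unitVec α) = blk n x then Si else Sf)
        | _, _ => (0 : ℝ)) := by
  rcases f with α | m <;> rcases a with β | m'
  · exact le_rfl
  · show 0 ≤ (if blk n (y + unitVec α) = blk n y then Si else Sf)
    split_ifs <;> assumption
  · show 0 ≤ (if blk n (x + unitVec β) = blk n x then Si else Sf)
    split_ifs <;> assumption
  · exact le_rfl

/-- [folklore] **THE LEG LETTER ON THE WORD's SUPPORT, FACE-SPLIT**: for a sign-symmetric leg (`trK G = sgnK G`) with interior ∕ face column letters `Si` ∕ `Sf`, every non-zero entry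
`W y x f a` of the word sees `|G x y a f| ≤` the face-split weight of its field bond (interior `Si`, face-crossing `Sf`). -/
theorem abs_leg_le_splitWeight {G : MKer (3 + 1) (Fib 3)} {Si Sf : ℝ} (hsym : trK G = sgnK G)
    (hcolI : ∀ (μ : Fin (3 + 1)) (Y : Site (3 + 1)) (κ : Fin (3 + 1)) (u : Site (3 + 1)), blk n (u + unitVec κ) = blk n u → |colH G n μ Y κ u| ≤ Si)
    (hcolF : ∀ (μ : Fin (3 + 1)) (Y : Site (3 + 1)) (κ : Fin (3 + 1)) (u : Site (3 + 1)), |colH G n μ Y κ u| ≤ Sf)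
    (x y : Site (3 + 1)) (a f : Fib 3) :
    (comp (diagK h) (comp (diagK g) (Dsh (d := 3) n) - comp (Dsh (d := 3) n) (diagK g))
            - comp (comp (diagK g) (Dsh (d := 3) n) - comp (Dsh (d := 3) n) (diagK g)) (diagK h)) y x f a ≠ 0 →
    |G x y a f| ≤ (match f, a with
        | Sum.inl α, Sum.inr _ => (if blk n (y + unitVec α) = blk n y then Si else Sf)
        | Sum.inr _, Sum.inl α => (if blk n (x + unitVec α) = blk n x then Si else Sf)
        | _, _ => (0 : ℝ)) := by
  intro hne
  have hcolW : ∀ (m : Fin (3 + 1)) (Y : Site (3 + 1)) (α : Fin (3 + 1)) (u : Site (3 + 1)),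
      |colH G n m Y α u| ≤ (if blk n (u + unitVec α) = blk n u then Si else Sf) := by
    intro m Y α u
    split_ifs with hI
    · exact hcolI m Y α u hI
    · exact hcolF m Y α u
  rcases f with α | m <;> rcases a with β | m'
  · exact absurd (word_inl_inl g h y x α β) hne
  · show |G x y (Sum.inr m') (Sum.inl α)| ≤ (if blk n (y + unitVec α) = blk n y then Si else Sf)
    by_cases hx : Literature.Probability.LatticeModels.Torus.proj n x = 0
    · have e : G x y (Sum.inr m') (Sum.inl α) = trK G y x (Sum.inl α) (Sum.inr m') := rfl
      rw [e, hsym, sgnK_apply, sgnF_inl, sgnF_inr, abs_mul, abs_mul, abs_one, abs_neg, abs_one, one_mul, one_mul]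
      have ex : x = (n : ℤ) • quo n x := eq_zsmul_quo_of_proj (N := n) hx
      have e2 : G y x (Sum.inl α) (Sum.inr m') = colH G n m' (quo n x) α y := by
        conv_lhs => rw [ex]
        rfl
      rw [e2]
      exact hcolW m' (quo n x) α y
    · exact absurd (word_inl_inr_eq_zero_of_proj_ne g h hx y α m') hne
  · show |G x y (Sum.inl β) (Sum.inr m)| ≤ (if blk n (x + unitVec β) = blk n x then Si else Sf)
    by_cases hy : Literature.Probability.LatticeModels.Torus.proj n y = 0
    · have ey : y = (n : ℤ) • quo n y := eq_zsmul_quo_of_proj (N := n) hy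
      have e2 : G x y (Sum.inl β) (Sum.inr m) = colH G n m (quo n y) β x := by
        conv_lhs => rw [ey]
        rfl
      rw [e2]
      exact hcolW m (quo n y) β x
    · refine absurd ?_ hne
      rw [← abs_eq_zero, abs_word_inr_inl, abs_eq_zero]
      exact word_inl_inr_eq_zero_of_proj_ne g h hy x β m
  · exact absurd (word_inr_inr g h y x m m') hne

/-- [folklore] **THE `Dsh`-WORD TADPOLE FAMILY AGAINST A SIGN-SYMMETRIC LEG WITH INTERIOR ∕ FACE COLUMN LETTERS IS A (5.10)-KERNEL** (the face-split twin of FILE 2's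
`decay510_half_tadpole_word`): `trK G = sgnK G`, `|colH G n μ Y κ u| ≤ Si` on bonds `(κ, u)` INSIDE a block (`blk n (u + e_κ) = blk n u`), `|colH G n μ Y κ u| ≤ Sf` on all bonds
(`0 ≤ Si, Sf`), weights `g`, `h z` as before ⟹
`Decay510 (z ↦ ½·tadpole G ([diagK (h z), [diagK g, Dsh n]])) (½·(2·(Ch·Cg·(e^{8nδ}+1)²·(4·(2·(Si·T₀ + Sf·F₀)))·Zl 4 (δ∕2·n)))) (δ∕2·n)`. -/
theorem decay510_half_tadpole_word_split {G : MKer (3 + 1) (Fib 3)} {Si Sf : ℝ} (hSi : 0 ≤ Si) (hSf : 0 ≤ Sf) (hsym : trK G = sgnK G)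
    (hcolI : ∀ (μ : Fin (3 + 1)) (Y : Site (3 + 1)) (κ : Fin (3 + 1)) (u : Site (3 + 1)), blk n (u + unitVec κ) = blk n u → |colH G n μ Y κ u| ≤ Si)
    (hcolF : ∀ (μ : Fin (3 + 1)) (Y : Site (3 + 1)) (κ : Fin (3 + 1)) (u : Site (3 + 1)), |colH G n μ Y κ u| ≤ Sf)
    (g : Site (3 + 1) → Fib 3 → ℝ) (h : Site (3 + 1) → Site (3 + 1) → Fib 3 → ℝ) {Cg Ch δ : ℝ} (hCg : 0 ≤ Cg) (hCh : 0 ≤ Ch) (hδ : 0 < δ)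
    (hg : ∀ x a, |g x a| ≤ Cg * Real.exp (-δ * l1 (x - (n : ℤ) • (0 : Site (3 + 1)))))
    (hh : ∀ z x a, |h z x a| ≤ Ch * Real.exp (-δ * l1 (x - (n : ℤ) • z))) :
    Decay510 (fun z : Site (3 + 1) => (1 / 2 : ℝ) * tadpole G
        (comp (diagK (h z)) (comp (diagK g) (Dsh (d := 3) n) - comp (Dsh (d := 3) n) (diagK g))
            - comp (comp (diagK g) (Dsh (d := 3) n) - comp (Dsh (d := 3) n) (diagK g)) (diagK (h z))))
      ((1 / 2 : ℝ) * (2 * (Ch * Cg * (Real.exp (δ * (((3 : ℝ) + 1) * (2 * n))) + 1) ^ 2 * (4 * (2 * (Si * ((n : ℝ) ^ (3 + 1) * (((3 : ℝ) + 1) * n)) + Sf * (((3 : ℝ) + 1) * ((((3 : ℕ) : ℝ) + 1) * (n : ℝ) ^ (3 + 1))))))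
            * Zl 4 (δ / 2 * n))))
      (δ / 2 * n) := by
  intro z
  have hm := word_wmass_le (n := n) g (h z) (yb := 0) (yz := z) hCg hCh hδ hSi hSf hg (hh z)
  rw [sub_zero] at hm
  have ht := abs_tadpole_le_of_weightOn_mass (L := G) (W := (comp (diagK (h z)) (comp (diagK g) (Dsh (d := 3) n) - comp (Dsh (d := 3) n) (diagK g))
            - comp (comp (diagK g) (Dsh (d := 3) n) - comp (Dsh (d := 3) n) (diagK g)) (diagK (h z))))
    (ω := fun y x f a => (match f, a with
        | Sum.inl α, Sum.inr _ => (if blk n (y + unitVec α) = blk n y then Si else Sf)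
        | Sum.inr _, Sum.inl α => (if blk n (x + unitVec α) = blk n x then Si else Sf)
        | _, _ => (0 : ℝ)))
    (fun y x f a => splitWeight_nonneg hSi hSf y x f a)
    (fun x y a f hne => abs_leg_le_splitWeight (n := n) g (h z) hsym hcolI hcolF x y a f hne) hm.1
  have hb := ht.trans hm.2
  rw [abs_mul, abs_of_pos (by norm_num : (0 : ℝ) < 1 / 2)]
  calc (1 / 2 : ℝ) * |tadpole G (comp (diagK (h z)) (comp (diagK g) (Dsh (d := 3) n) - comp (Dsh (d := 3) n) (diagK g))
            - comp (comp (diagK g) (Dsh (d := 3) n) - comp (Dsh (d := 3) n) (diagK g)) (diagK (h z)))|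
      ≤ (1 / 2 : ℝ) * (2 * (Ch * Cg * (Real.exp (δ * (((3 : ℝ) + 1) * (2 * n))) + 1) ^ 2 * (4 * (2 * (Si * ((n : ℝ) ^ (3 + 1) * (((3 : ℝ) + 1) * n)) + Sf * (((3 : ℝ) + 1) * ((((3 : ℕ) : ℝ) + 1) * (n : ℝ) ^ (3 + 1))))))
            * Zl 4 (δ / 2 * n)) * Real.exp (-(δ / 2 * n) * l1 z)) := mul_le_mul_of_nonneg_left hb (by norm_num)
    _ = _ := by ring

end WeightedMass

end Summit.QuantumFields.BalabanUV.Beta.D1BFx.DshWordSplitTadpole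

end
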